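import Literature.NumberTheory.EllipticCurves.CongruentNumberCurveAdditiveReduction
import Literature.NumberTheory.EllipticCurves.CongruentNumberCurveSupersingular
import HarnessLib

/-!
# `E_n` is minimal and additive at `2` for even squarefree `n`: all Euler factors of `L(E_n, s)` at `p ∣ 2n` are trivial

Fifth sibling file of `Literature.NumberTheory.EllipticCurves.BSDAnalyticRank` for **bsd.S29**, on
the leaf `Literature.NumberTheory.EllipticCurves.hasEntireLFunction_congruentNumberCurve` (continuation of `L(E_n, s)`, `n`
squarefree). The printed `L`-function of `E_n = C_n : y² = x³ - n² x` is the product over the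
primes `p ∤ 2n` (Top–Yui, MSRI Publ. 44 (2008), §3, p. 617; Ireland–Rosen Ch. 18 §2 (xi), §6:
`∏_{p ∤ Δ}`, `Δ = 2⁶ D³`); Mathlib's `WeierstrassCurve.LFunction` is the complete Euler product,
whose factor at a place of additive reduction is `1` (Silverman, *AEC* §C.16). The companion file
`CongruentNumberCurveAdditiveReduction` shows that `E_n` has additive reduction at the odd `p ∣ n`
and, for odd `n`, at `2`, using Silverman's Remark VII.1.1 (`ord_p(Δ) < 12` ⇒ minimal). For even
squarefree `n = 2m` one has `ord₂(Δ) = ord₂(64 n⁶) = 12` and the remark does not apply; this file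
supplies the missing case by the direct argument of Silverman VII.1 (an integral equation is
minimal iff no admissible change of variables `[u, r, s, t]` with `ord(u) > 0` keeps it integral;
cf. Exercise 7.1 and Tate's algorithm):

* `Literature.NumberTheory.EllipticCurves.isMinimalAt_congruentNumberCurve_two_of_even`: **`y² = x³ - n² x` is a minimal equation at
  `2` for even squarefree `n`.** If `[u, r, s, t] • E_n` were `2`-integral with `|u|₂ < 1`, then
  integrality of `Δ' = u⁻¹² Δ` forces `ord₂(u) = 1`, and integrality of
  `a₁' = 2s/u`, `a₂' = (3r - s²)/u²`, `a₃' = 2t/u³`, `a₄' = (-n² + 3r² - 2st)/u⁴` forces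
  `s ∈ ℤ₂`, `4 ∣ 3r - s²`, `4 ∣ t`, `16 ∣ -n² + 3r² - 2st`; if `s` is even then `4 ∣ r` and
  `16 ∣ n²`, contradicting `2 ∥ n`; if `s` is a unit then `s² ≡ 1 (8)`, `r` is a unit,
  `3r² ≡ 3 (8)`, `n² ≡ 4 (8)`, `2st ≡ 0 (8)`, so `-n² + 3r² - 2st ≡ -1 (8)` is a unit,
  contradicting `16 ∣ …`. (All congruences are carried by the valuation of `ℚ₂ = ℚ_v`; the only
  input on the residue field is `#κ(v) = 2`, whence `x² ≡ 1 (8)` for `2`-adic units,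
  `Literature.NumberTheory.EllipticCurves.valued_sq_sub_one_le_of_valued_eq_one`.)
* `Literature.NumberTheory.EllipticCurves.hasAdditiveReductionAt_of_isMinimalAt`: Silverman VII.5.1(c) for an equation already known
  to be minimal at `v` (variant of `hasAdditiveReductionAt_of_valuation`);
* `Literature.NumberTheory.EllipticCurves.hasAdditiveReductionAt_congruentNumberCurve_two_of_even`,
  `Literature.NumberTheory.EllipticCurves.lFunction_congruentNumberCurve_apply_two_of_even`: additive reduction of `E_n` at `2` and
  `a₂(E_n) = 0` for even squarefree `n`;
* `Literature.NumberTheory.EllipticCurves.hasAdditiveReductionAt_congruentNumberCurve`,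
  `Literature.NumberTheory.EllipticCurves.lFunction_congruentNumberCurve_apply_eq_zero_of_dvd_two_mul`: **for squarefree `n`, `E_n`
  has additive reduction at every prime `p ∣ 2n`, and `a_p(E_n) = 0` there** — so the Dirichlet
  coefficients of Mathlib's complete `L(E_n, s)` at every prime agree with those of the printed
  product over `p ∤ 2n` (at `p ∤ 2n` by `Literature.NumberTheory.Automorphic.lFunction_map_apply_prime_of_not_dvd`):
  `Literature.NumberTheory.EllipticCurves.lFunction_congruentNumberCurve_apply_prime`, **`a_p(E_n) = 0` if `p ∣ 2n` and
  `a_p(E_n) = p + 1 - #Ẽ_n(𝔽_p)` otherwise**, for every squarefree `n` and every prime `p`.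

## References

* J. H. Silverman, *The Arithmetic of Elliptic Curves*, GTM 106, 2nd ed. 2009: VII.1 (minimal
  equations, Remark 1.1, Prop. 1.3), VII.5 Prop. 5.1(c), §C.16. [cite: SilvermanAEC2009]
* J. Top, N. Yui, *Congruent number problems and their variants*, MSRI Publ. 44 (2008), §3,
  p. 617. [cite: TopYui2008Congruent]
* K. Ireland, M. Rosen, *A Classical Introduction to Modern Number Theory*, 2nd ed., Ch. 18 §2 (xi),
  §6. [cite: IrelandRosen1990]
-/

noncomputable section

open scoped Classical

open IsDedekindDomain WeierstrassCurve

namespace Literature.NumberTheory.EllipticCurves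

/-! ### Discreteness of `ℤᵐ⁰` -/

/-- In `ℤᵐ⁰`, `x < exp k` implies `x ≤ exp (k - 1)`. [folklore] -/
theorem withZero_le_exp_sub_one_of_lt_exp {x : WithZero (Multiplicative ℤ)} {k : ℤ}
    (h : x < WithZero.exp k) : x ≤ WithZero.exp (k - 1) := by
  induction x using WithZero.expRecOn with
  | zero => exact zero_le
  | exp a =>
    rw [WithZero.exp_lt_exp] at h
    rw [WithZero.exp_le_exp]
    omega

/-- In `ℤᵐ⁰`, `exp k * y ≤ 1` implies `y ≤ exp (-k)`. [folklore] -/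
theorem withZero_le_exp_neg_of_exp_mul_le {y : WithZero (Multiplicative ℤ)} {k : ℤ}
    (h : WithZero.exp k * y ≤ 1) : y ≤ WithZero.exp (-k) :=
  calc y = WithZero.exp (-k) * (WithZero.exp k * y) := by
          rw [← mul_assoc, ← WithZero.exp_add, neg_add_cancel, WithZero.exp_zero, one_mul]
    _ ≤ WithZero.exp (-k) * 1 := mul_le_mul' le_rfl h
    _ = WithZero.exp (-k) := mul_one _

/-- `exp a * exp b = exp (a + b)` in `ℤᵐ⁰` (Mathlib's `WithZero.exp_add`, reversed). [folklore] -/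
theorem withZero_exp_mul_exp (a b : ℤ) :
    WithZero.exp a * WithZero.exp b = WithZero.exp (a + b) :=
  (WithZero.exp_add a b).symm

/-- Cancellation of `exp k` in `ℤᵐ⁰`: `exp k * x ≤ exp k * y → x ≤ y`. [folklore] -/
theorem withZero_le_of_exp_mul_le_exp_mul {x y : WithZero (Multiplicative ℤ)} {k : ℤ}
    (h : WithZero.exp k * x ≤ WithZero.exp k * y) : x ≤ y :=
  calc x = WithZero.exp (-k) * (WithZero.exp k * x) := by
          rw [← mul_assoc, ← WithZero.exp_add, neg_add_cancel, WithZero.exp_zero, one_mul]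
    _ ≤ WithZero.exp (-k) * (WithZero.exp k * y) := mul_le_mul' le_rfl h
    _ = y := by rw [← mul_assoc, ← WithZero.exp_add, neg_add_cancel, WithZero.exp_zero, one_mul]

/-! ### Additive reduction of an equation known to be minimal -/

section General

variable {A : Type*} [CommRing A] [IsDedekindDomain A] {K : Type*} [Field K]
  [Algebra A K] [IsFractionRing A K] (v : HeightOneSpectrum A) (W : WeierstrassCurve K)

/-- **Silverman VII.5.1(c) for an equation minimal at `v`**: if `W` is a minimal equation at `v`
with `|Δ|_v < 1` and `|c₄|_v < 1` then `W` has additive reduction at `v` (for the tree's predicate,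
i.e. Mathlib's `HasAdditiveReduction` of the chosen minimal model, to which the two valuations
transfer by Silverman VII.1.3(b), `hasAdditiveReduction_iff_of_isMinimal_of_eq_smul`).
[cite: SilvermanAEC2009, VII.5 Prop. 5.1(c) and VII.1 Prop. 1.3(b)] -/
theorem hasAdditiveReductionAt_of_isMinimalAt (hmin : W.IsMinimalAt v)
    (hΔ : v.valuation K W.Δ < 1) (hc₄ : v.valuation K W.c₄ < 1) (hΔ0 : W.Δ ≠ 0) :
    W.HasAdditiveReductionAt v := by
  set X : WeierstrassCurve (v.adicCompletion K) := W.baseChange (v.adicCompletion K) with hX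
  haveI hminX : X.IsMinimal (v.adicCompletionIntegers K) := hmin
  have hΔX : X.Δ ≠ 0 := by
    rw [hX, baseChange, map_Δ]
    exact (map_ne_zero _).mpr hΔ0
  have hadd : X.HasAdditiveReduction (v.adicCompletionIntegers K) := by
    refine (hasAdditiveReduction_iff _ _).mpr ⟨hminX, ?_, ?_⟩
    · rw [hX, baseChange, map_Δ]
      exact valuation_maximalIdeal_adicCompletion_lt_one v hΔ
    · rw [hX, baseChange, map_c₄]
      exact valuation_maximalIdeal_adicCompletion_lt_one v hc₄
  have heq : W.localMinimalModel v =
      (X.exists_isMinimal (v.adicCompletionIntegers K)).choose • X := rfl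
  exact (hasAdditiveReduction_iff_of_isMinimal_of_eq_smul (v.adicCompletionIntegers K)
    heq hΔX).mpr hadd

end General

/-! ### `2`-adic units: `x² ≡ 1 (mod 8)` from `#κ(v) = 2` -/

section TwoAdic

open Rat.HeightOneSpectrum

variable (v : HeightOneSpectrum (NumberField.RingOfIntegers ℚ))

/-- At the place over `2`: `|2|_v = exp(-1)`. [folklore] -/
theorem valued_two (hv : natGenerator v = 2) :
    Valued.v (2 : v.adicCompletion ℚ) = WithZero.exp (-1 : ℤ) := by
  have h := Literature.NumberTheory.GaloisRepresentations.Rat.valuation_natGenerator v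
  rw [hv, Nat.cast_ofNat] at h
  rw [← map_ofNat (algebraMap ℚ (v.adicCompletion ℚ)) 2, GaloisRepresentations.valued_algebraMap_adicCompletion, h]

/-- At the place over `2`: `|4|_v = exp(-2)`. [folklore] -/
theorem valued_four (hv : natGenerator v = 2) :
    Valued.v (4 : v.adicCompletion ℚ) = WithZero.exp (-2 : ℤ) := by
  rw [show (4 : v.adicCompletion ℚ) = 2 * 2 by norm_num, Valuation.map_mul, valued_two v hv,
    withZero_exp_mul_exp]
  norm_num

/-- At the place over `2`: `|3|_v = 1`. [folklore] -/
theorem valued_three (hv : natGenerator v = 2) :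
    Valued.v (3 : v.adicCompletion ℚ) = 1 := by
  have h := Literature.NumberTheory.GaloisRepresentations.Rat.valuation_intCast_eq_one v (n := 3) (by rw [hv]; decide)
  rw [← map_ofNat (algebraMap ℚ (v.adicCompletion ℚ)) 3, GaloisRepresentations.valued_algebraMap_adicCompletion]
  exact_mod_cast h

/-- At the place over `2`: an odd natural number is a `v`-adic unit. [folklore] -/
theorem valued_natCast_of_odd (hv : natGenerator v = 2) {m : ℕ} (hm : Odd m) :
    Valued.v (m : v.adicCompletion ℚ) = 1 := by
  have h2m : ¬ (natGenerator v : ℤ) ∣ m := by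
    rw [hv]
    intro h
    have : 2 ∣ m := by exact_mod_cast h
    exact (Nat.not_even_iff_odd.mpr hm) (even_iff_two_dvd.mpr this)
  have h := Literature.NumberTheory.GaloisRepresentations.Rat.valuation_intCast_eq_one v h2m
  rw [← map_natCast (algebraMap ℚ (v.adicCompletion ℚ)) m, GaloisRepresentations.valued_algebraMap_adicCompletion]
  exact_mod_cast h

/-- **The residue field at `2` has two elements**: every `v`-adic integer `a` (`|a|_v ≤ 1`) is
congruent to `0` or to `1`, i.e. `|a|_v < 1` or `|a - 1|_v < 1` (Mathlib:
`#κ(𝓞_v) = p_v`, `natCard_residueField_adicCompletionIntegers`). [folklore] -/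
theorem valued_lt_one_or_valued_sub_one_lt_one (hv : natGenerator v = 2)
    {a : v.adicCompletion ℚ} (ha : Valued.v a ≤ 1) :
    Valued.v a < 1 ∨ Valued.v (a - 1) < 1 := by
  set O := v.adicCompletionIntegers ℚ with hO
  set o : O := ⟨a, (HeightOneSpectrum.mem_adicCompletionIntegers _ ℚ v).mpr ha⟩ with ho
  have hcard : Nat.card (IsLocalRing.ResidueField O) = 2 := by
    rw [natCard_residueField_adicCompletionIntegers v]
    exact hv
  -- in a type with two elements, everything other than `0` equals `1`
  have h01 : ∀ x : IsLocalRing.ResidueField O, x = 0 ∨ x = 1 := by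
    intro x
    obtain ⟨y, hy, huniq⟩ := (Nat.card_eq_two_iff' (0 : IsLocalRing.ResidueField O)).mp hcard
    by_cases hx : x = 0
    · exact Or.inl hx
    · exact Or.inr ((huniq x hx).trans (huniq 1 one_ne_zero).symm)
  -- membership in `𝔪_v` is `|·|_v < 1`
  have hmem : ∀ b : O, b ∈ IsLocalRing.maximalIdeal O → Valued.v (b : v.adicCompletion ℚ) < 1 := by
    intro b hb
    have hnu : ¬ IsUnit b := (IsLocalRing.mem_maximalIdeal _).mp hb
    rw [HeightOneSpectrum.adicCompletionIntegers.isUnit_iff_valued_eq_one] at hnu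
    exact lt_of_le_of_ne ((HeightOneSpectrum.mem_adicCompletionIntegers _ ℚ v).mp b.2) hnu
  rcases h01 (IsLocalRing.residue O o) with h0 | h1
  · left
    exact hmem o ((IsLocalRing.residue_eq_zero_iff o).mp h0)
  · right
    have h1' : IsLocalRing.residue O (o - 1) = 0 := by rw [map_sub, map_one, h1, sub_self]
    have := hmem (o - 1) ((IsLocalRing.residue_eq_zero_iff _).mp h1')
    simpa [ho] using this

/-- **Squares of `2`-adic units are `≡ 1 (mod 8)`**: `|s|_v = 1 ⇒ |s² - 1|_v ≤ exp(-3)` at the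
place over `2`. Write `s² - 1 = (s - 1)(s + 1)`; `s - 1 ∈ 2𝓞`, and applying the dichotomy of
`valued_lt_one_or_valued_sub_one_lt_one` to `(s - 1)/2` one of `s - 1`, `s + 1 = (s - 3) + 4`
lies in `4𝓞`. [folklore] -/
theorem valued_sq_sub_one_le_of_valued_eq_one (hv : natGenerator v = 2)
    {s : v.adicCompletion ℚ} (hs : Valued.v s = 1) :
    Valued.v (s ^ 2 - 1) ≤ WithZero.exp (-3 : ℤ) := by
  have V2 := valued_two v hv
  have V4 := valued_four v hv
  have h20 : (2 : v.adicCompletion ℚ) ≠ 0 := by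
    intro h; rw [h, Valuation.map_zero] at V2; exact WithZero.exp_ne_zero V2.symm
  -- `s ≡ 1 (mod 2)`
  have hs1 : Valued.v (s - 1) < 1 :=
    (valued_lt_one_or_valued_sub_one_lt_one v hv hs.le).resolve_left (by rw [hs]; exact lt_irrefl 1)
  have hs1' : Valued.v (s - 1) ≤ WithZero.exp (-1 : ℤ) := by
    have := withZero_le_exp_sub_one_of_lt_exp (k := 0) (by rwa [WithZero.exp_zero])
    simpa using this
  -- `a = (s - 1)/2` is integral
  set a := (s - 1) / 2 with ha
  have hsa : s - 1 = 2 * a := by rw [ha]; field_simp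
  have hVa : Valued.v a ≤ 1 := by
    refine withZero_le_of_exp_mul_le_exp_mul (k := -1) ?_
    rw [mul_one, ← V2, ← Valuation.map_mul, ← hsa]
    exact hs1'.trans V2.ge
  have hsp1 : Valued.v (s + 1) ≤ WithZero.exp (-1 : ℤ) := by
    have : s + 1 = (s - 1) + 2 := by ring
    rw [this]
    exact Valuation.map_add_le _ hs1' V2.le
  rcases valued_lt_one_or_valued_sub_one_lt_one v hv hVa with h | h
  · -- `4 ∣ s - 1`
    have ha1 : Valued.v a ≤ WithZero.exp (-1 : ℤ) := by
      have := withZero_le_exp_sub_one_of_lt_exp (k := 0) (by rwa [WithZero.exp_zero])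
      simpa using this
    have hsm1 : Valued.v (s - 1) ≤ WithZero.exp (-2 : ℤ) := by
      rw [hsa, Valuation.map_mul, V2]
      calc WithZero.exp (-1 : ℤ) * Valued.v a ≤ WithZero.exp (-1 : ℤ) * WithZero.exp (-1 : ℤ) :=
            mul_le_mul' le_rfl ha1
        _ = WithZero.exp (-2 : ℤ) := by rw [withZero_exp_mul_exp]; norm_num
    have : s ^ 2 - 1 = (s - 1) * (s + 1) := by ring
    rw [this, Valuation.map_mul]
    calc Valued.v (s - 1) * Valued.v (s + 1) ≤ WithZero.exp (-2 : ℤ) * WithZero.exp (-1 : ℤ) :=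
          mul_le_mul' hsm1 hsp1
      _ = WithZero.exp (-3 : ℤ) := by rw [withZero_exp_mul_exp]; norm_num
  · -- `4 ∣ s - 3`, so `4 ∣ s + 1`
    have ha1 : Valued.v (a - 1) ≤ WithZero.exp (-1 : ℤ) := by
      have := withZero_le_exp_sub_one_of_lt_exp (k := 0) (by rwa [WithZero.exp_zero])
      simpa using this
    have hsm3 : Valued.v (s - 3) ≤ WithZero.exp (-2 : ℤ) := by
      have : s - 3 = 2 * (a - 1) := by rw [ha]; field_simp; ring
      rw [this, Valuation.map_mul, V2]
      calc WithZero.exp (-1 : ℤ) * Valued.v (a - 1)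
          ≤ WithZero.exp (-1 : ℤ) * WithZero.exp (-1 : ℤ) := mul_le_mul' le_rfl ha1
        _ = WithZero.exp (-2 : ℤ) := by rw [withZero_exp_mul_exp]; norm_num
    have hsp1' : Valued.v (s + 1) ≤ WithZero.exp (-2 : ℤ) := by
      have : s + 1 = (s - 3) + 4 := by ring
      rw [this]
      exact Valuation.map_add_le _ hsm3 V4.le
    have : s ^ 2 - 1 = (s - 1) * (s + 1) := by ring
    rw [this, Valuation.map_mul]
    calc Valued.v (s - 1) * Valued.v (s + 1) ≤ WithZero.exp (-1 : ℤ) * WithZero.exp (-2 : ℤ) :=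
          mul_le_mul' hs1' hsp1'
      _ = WithZero.exp (-3 : ℤ) := by rw [withZero_exp_mul_exp]; norm_num

end TwoAdic

/-! ### Minimality of `y² = x³ - n² x` at `2` for even squarefree `n` -/

section Minimal

open Rat.HeightOneSpectrum

variable (v : HeightOneSpectrum (NumberField.RingOfIntegers ℚ))

/-- An even squarefree number is `2m` with `m` odd. [folklore] -/
theorem exists_eq_two_mul_odd_of_squarefree_of_even {n : ℕ} (hsq : Squarefree n)
    (heven : Even n) : ∃ m, n = 2 * m ∧ Odd m := by
  obtain ⟨m, hm⟩ := heven
  refine ⟨m, by omega, ?_⟩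
  by_contra hodd
  rw [Nat.not_odd_iff_even] at hodd
  obtain ⟨k, hk⟩ := hodd
  have h4 : 2 * 2 ∣ n := ⟨k, by omega⟩
  exact absurd (Nat.isUnit_iff.mp (hsq 2 h4)) (by norm_num)

/-- `|Δ(E_{2m})|_v = |64 (2m)⁶|_v = exp(-12)` at the place over `2`, for odd `m`. [folklore] -/
theorem valuation_congruentNumberCurve_Δ_of_even (hv : natGenerator v = 2) {m : ℕ} (hm : Odd m) :
    v.valuation ℚ (congruentNumberCurve (2 * m)).Δ = WithZero.exp (-12 : ℤ) := by
  have hv2 : v.valuation ℚ (2 : ℚ) = WithZero.exp (-1 : ℤ) := by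
    have := Literature.NumberTheory.GaloisRepresentations.Rat.valuation_natGenerator v
    rwa [hv, Nat.cast_ofNat] at this
  have hvm : v.valuation ℚ (m : ℚ) = 1 := by
    have h2m : ¬ (natGenerator v : ℤ) ∣ m := by
      rw [hv]
      intro h
      have : 2 ∣ m := by exact_mod_cast h
      exact (Nat.not_even_iff_odd.mpr hm) (even_iff_two_dvd.mpr this)
    have := Literature.NumberTheory.GaloisRepresentations.Rat.valuation_intCast_eq_one v h2m
    exact_mod_cast this
  rw [congruentNumberCurve_Δ, show (64 : ℚ) = 2 ^ 6 by norm_num, Nat.cast_mul, Nat.cast_ofNat,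
    mul_pow]
  simp only [Valuation.map_mul, Valuation.map_pow, hv2, hvm, one_pow, mul_one]
  rw [← pow_add, ← WithZero.exp_nsmul]
  norm_num

/-- **`y² = x³ - n² x` is a minimal Weierstrass equation at `2` for even squarefree `n`**
(Silverman, *AEC* VII.1: minimality means that no admissible change of variables keeps the
equation integral while lowering `ord(Δ)`; here `ord₂(Δ) = 12` and Remark VII.1.1 does not apply).
Proof, with `n = 2m`, `m` odd, and `[u, r, s, t] • E_n` assumed `2`-integral with `|u|₂ < 1`:
integrality of `Δ' = u⁻¹² Δ` gives `ord₂(u) = 1`; then `a₁' = 2s/u`, `a₃' = 2t/u³`,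
`a₂' = (3r - s²)/u²`, `a₄' = (-n² + 3r² - 2st)/u⁴` integral give `|s| ≤ 1`, `|t| ≤ exp(-2)`,
`|3r - s²| ≤ exp(-2)`, `|-n² + 3r² - 2st| ≤ exp(-4)`. If `|s| < 1` then `|r| ≤ exp(-2)` and
`|n²| ≤ exp(-4)`, contradicting `|n²| = exp(-2)`. If `|s| = 1` then `s² ≡ 1 (8)`
(`valued_sq_sub_one_le_of_valued_eq_one`), so `3r ≡ 1 (4)`, `r` is a unit, `3r² ≡ 3 (8)`,
`n² = 4m² ≡ 4 (8)`, `2st ≡ 0 (8)`, whence `-n² + 3r² - 2st ≡ -1 (8)` is a unit, contradicting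
`|…| ≤ exp(-4)`. [cite: SilvermanAEC2009, VII.1 (minimal Weierstrass equations; Remark 1.1, Prop. 1.3)] -/
theorem isMinimalAt_congruentNumberCurve_two_of_even {n : ℕ} (hsq : Squarefree n) (heven : Even n)
    (hv : natGenerator v = 2) : (congruentNumberCurve n).IsMinimalAt v := by
  obtain ⟨m, rfl, hm⟩ := exists_eq_two_mul_odd_of_squarefree_of_even hsq heven
  have V2 := valued_two v hv
  have V3 := valued_three v hv
  have V4 := valued_four v hv
  have Vm := valued_natCast_of_odd v hv hm
  set X : WeierstrassCurve (v.adicCompletion ℚ) :=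
    (congruentNumberCurve (2 * m)).baseChange (v.adicCompletion ℚ) with hX
  have hXa₁ : X.a₁ = 0 := by simp [hX, baseChange]
  have hXa₂ : X.a₂ = 0 := by simp [hX, baseChange]
  have hXa₃ : X.a₃ = 0 := by simp [hX, baseChange]
  have hXa₄ : X.a₄ = -((2 : v.adicCompletion ℚ) * m) ^ 2 := by
    rw [hX, baseChange, map_a₄, congruentNumberCurve_a₄, map_neg, map_pow, map_natCast, Nat.cast_mul,
      Nat.cast_ofNat]
  have hXΔ : Valued.v X.Δ = WithZero.exp (-12 : ℤ) := by
    rw [hX, baseChange, map_Δ, GaloisRepresentations.valued_algebraMap_adicCompletion,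
      valuation_congruentNumberCurve_Δ_of_even v hv hm]
  have hV1 : ∀ x : v.adicCompletion ℚ,
      x ∈ (algebraMap (v.adicCompletionIntegers ℚ) (v.adicCompletion ℚ)).range → Valued.v x ≤ 1 :=
    fun x hx ↦ (valued_le_one_iff_mem_range_adicCompletionIntegers v x).mpr hx
  show X.IsMinimal (v.adicCompletionIntegers ℚ)
  rw [isMinimal_iff_of_le_one_iff (valued_le_one_iff_mem_range_adicCompletionIntegers v)]
  refine ⟨?_, fun C hC ↦ ?_⟩
  · obtain ⟨h₁, h₂, h₃, h₄, h₆⟩ := valuation_congruentNumberCurve_a_le_one v (2 * m)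
    exact (congruentNumberCurve (2 * m)).isIntegralAt_of_valuation_le_one v h₁ h₂ h₃ h₄ h₆
  -- integrality of the transformed coefficients and discriminant
  obtain ⟨h1, h2, h3, h4, -⟩ := (isIntegral_iff_forall_mem_range (C • X)).mp hC
  replace h1 := hV1 _ h1
  replace h2 := hV1 _ h2
  replace h3 := hV1 _ h3
  replace h4 := hV1 _ h4
  have e1 : (C • X).a₁ = ↑C.u⁻¹ * (2 * C.s) := by rw [variableChange_a₁, hXa₁, zero_add]
  have e2 : (C • X).a₂ = ↑C.u⁻¹ ^ 2 * (3 * C.r - C.s ^ 2) := by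
    rw [variableChange_a₂, hXa₁, hXa₂]; ring
  have e3 : (C • X).a₃ = ↑C.u⁻¹ ^ 3 * (2 * C.t) := by rw [variableChange_a₃, hXa₁, hXa₃]; ring
  have e4 : (C • X).a₄ = ↑C.u⁻¹ ^ 4 *
      (-((2 : v.adicCompletion ℚ) * m) ^ 2 + 3 * C.r ^ 2 - 2 * C.s * C.t) := by
    rw [variableChange_a₄, hXa₁, hXa₂, hXa₃, hXa₄]; ring
  rw [e1, Valuation.map_mul] at h1
  rw [e2, Valuation.map_mul, Valuation.map_pow] at h2
  rw [e3, Valuation.map_mul, Valuation.map_pow] at h3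
  rw [e4, Valuation.map_mul, Valuation.map_pow] at h4
  have hΔ' : Valued.v (C • X).Δ ≤ 1 := by
    obtain ⟨d, hd⟩ := Δ_integral_of_isIntegral (v.adicCompletionIntegers ℚ) (C • X)
    rw [← hd]
    exact hV1 _ ⟨d, rfl⟩
  rw [variableChange_Δ, Valuation.map_mul, Valuation.map_pow, hXΔ] at hΔ'
  rw [variableChange_Δ, Valuation.map_mul, Valuation.map_pow, hXΔ]
  set U : WithZero (Multiplicative ℤ) := Valued.v (↑C.u⁻¹ : v.adicCompletion ℚ) with hU
  by_cases hU1 : U ≤ 1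
  · calc U ^ 12 * WithZero.exp (-12 : ℤ) ≤ 1 * WithZero.exp (-12 : ℤ) :=
          mul_le_mul' (pow_le_one' hU1 _) le_rfl
      _ = WithZero.exp (-12 : ℤ) := one_mul _
  exfalso
  replace hU1 : 1 < U := not_le.mp hU1
  have hU0 : U ≠ 0 := (Valuation.ne_zero_iff _).mpr (Units.ne_zero _)
  -- `ord(u) = 1`
  have hUe : U = WithZero.exp (1 : ℤ) := by
    have hl1 : 0 < WithZero.log U := WithZero.lt_log_of_exp_lt (by rwa [WithZero.exp_zero])
    have hl2 : 12 * WithZero.log U + (-12) ≤ 0 := by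
      have hne : U ^ 12 * WithZero.exp (-12 : ℤ) ≠ 0 :=
        mul_ne_zero (pow_ne_zero _ hU0) WithZero.exp_ne_zero
      have := (WithZero.log_le_log hne one_ne_zero).mpr hΔ'
      rw [WithZero.log_mul (pow_ne_zero _ hU0) WithZero.exp_ne_zero, WithZero.log_pow,
        WithZero.log_exp, WithZero.log_one] at this
      simpa [nsmul_eq_mul] using this
    have hlog : WithZero.log U = 1 := by omega
    rw [← WithZero.exp_log hU0, hlog]
  have hUe2 : U ^ 2 = WithZero.exp (2 : ℤ) := by rw [hUe, ← WithZero.exp_nsmul]; norm_num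
  have hUe3 : U ^ 3 = WithZero.exp (3 : ℤ) := by rw [hUe, ← WithZero.exp_nsmul]; norm_num
  have hUe4 : U ^ 4 = WithZero.exp (4 : ℤ) := by rw [hUe, ← WithZero.exp_nsmul]; norm_num
  rw [hUe] at h1
  rw [hUe2] at h2
  rw [hUe3] at h3
  rw [hUe4] at h4
  -- `|s| ≤ 1`, `|t| ≤ exp(-2)`, `|3r - s²| ≤ exp(-2)`, `|E| ≤ exp(-4)`
  have hs : Valued.v C.s ≤ 1 := by
    have h := withZero_le_exp_neg_of_exp_mul_le h1
    rw [Valuation.map_mul, V2] at h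
    exact withZero_le_of_exp_mul_le_exp_mul (k := -1) (by rwa [mul_one])
  have ht : Valued.v C.t ≤ WithZero.exp (-2 : ℤ) := by
    have h := withZero_le_exp_neg_of_exp_mul_le h3
    rw [Valuation.map_mul, V2] at h
    refine withZero_le_of_exp_mul_le_exp_mul (k := -1) ?_
    rw [withZero_exp_mul_exp]
    norm_num
    exact h
  have hrs : Valued.v (3 * C.r - C.s ^ 2) ≤ WithZero.exp (-2 : ℤ) :=
    withZero_le_exp_neg_of_exp_mul_le h2
  have hE : Valued.v (-((2 : v.adicCompletion ℚ) * m) ^ 2 + 3 * C.r ^ 2 - 2 * C.s * C.t) ≤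
      WithZero.exp (-4 : ℤ) :=
    withZero_le_exp_neg_of_exp_mul_le h4
  have hn2 : Valued.v (((2 : v.adicCompletion ℚ) * m) ^ 2) = WithZero.exp (-2 : ℤ) := by
    rw [Valuation.map_pow, Valuation.map_mul, V2, Vm, mul_one, ← WithZero.exp_nsmul]
    norm_num
  have hexp1 : WithZero.exp (-2 : ℤ) ≤ 1 := by
    rw [← WithZero.exp_zero, WithZero.exp_le_exp]; norm_num
  rcases hs.lt_or_eq with hslt | hseq
  · -- Case `|s| < 1`: then `4 ∣ r` and `16 ∣ n²`
    have hs1 : Valued.v C.s ≤ WithZero.exp (-1 : ℤ) := by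
      have := withZero_le_exp_sub_one_of_lt_exp (k := 0) (by rwa [WithZero.exp_zero])
      simpa using this
    have hs2 : Valued.v (C.s ^ 2) ≤ WithZero.exp (-2 : ℤ) := by
      rw [Valuation.map_pow, pow_two]
      calc Valued.v C.s * Valued.v C.s ≤ WithZero.exp (-1 : ℤ) * WithZero.exp (-1 : ℤ) :=
            mul_le_mul' hs1 hs1
        _ = WithZero.exp (-2 : ℤ) := by rw [withZero_exp_mul_exp]; norm_num
    have h3r : Valued.v (3 * C.r) ≤ WithZero.exp (-2 : ℤ) := by
      have : (3 : v.adicCompletion ℚ) * C.r = (3 * C.r - C.s ^ 2) + C.s ^ 2 := by ring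
      rw [this]
      exact Valuation.map_add_le _ hrs hs2
    have hr2 : Valued.v C.r ≤ WithZero.exp (-2 : ℤ) := by
      rwa [Valuation.map_mul, V3, one_mul] at h3r
    have h3r2 : Valued.v (3 * C.r ^ 2) ≤ WithZero.exp (-4 : ℤ) := by
      rw [Valuation.map_mul, V3, one_mul, Valuation.map_pow, pow_two]
      calc Valued.v C.r * Valued.v C.r ≤ WithZero.exp (-2 : ℤ) * WithZero.exp (-2 : ℤ) :=
            mul_le_mul' hr2 hr2
        _ = WithZero.exp (-4 : ℤ) := by rw [withZero_exp_mul_exp]; norm_num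
    have h2st : Valued.v (2 * C.s * C.t) ≤ WithZero.exp (-4 : ℤ) := by
      rw [Valuation.map_mul, Valuation.map_mul, V2]
      calc WithZero.exp (-1 : ℤ) * Valued.v C.s * Valued.v C.t
          ≤ WithZero.exp (-1 : ℤ) * WithZero.exp (-1 : ℤ) * WithZero.exp (-2 : ℤ) :=
            mul_le_mul' (mul_le_mul' le_rfl hs1) ht
        _ = WithZero.exp (-4 : ℤ) := by rw [withZero_exp_mul_exp, withZero_exp_mul_exp]; norm_num
    have hn2' : Valued.v (((2 : v.adicCompletion ℚ) * m) ^ 2) ≤ WithZero.exp (-4 : ℤ) := by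
      have : ((2 : v.adicCompletion ℚ) * m) ^ 2 = 3 * C.r ^ 2 - 2 * C.s * C.t -
          (-((2 : v.adicCompletion ℚ) * m) ^ 2 + 3 * C.r ^ 2 - 2 * C.s * C.t) := by ring
      rw [this]
      exact Valuation.map_sub_le _ (Valuation.map_sub_le _ h3r2 h2st) hE
    rw [hn2, WithZero.exp_le_exp] at hn2'
    norm_num at hn2'
  · -- Case `|s| = 1`: then `r` is a unit and `-n² + 3r² - 2st ≡ -1 (mod 8)`
    have hs21 := valued_sq_sub_one_le_of_valued_eq_one v hv hseq
    have h3r1 : Valued.v (3 * C.r - 1) ≤ WithZero.exp (-2 : ℤ) := by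
      have : (3 : v.adicCompletion ℚ) * C.r - 1 = (3 * C.r - C.s ^ 2) + (C.s ^ 2 - 1) := by ring
      rw [this]
      exact Valuation.map_add_le _ hrs
        (hs21.trans (by rw [WithZero.exp_le_exp]; norm_num))
    have hlt1 : WithZero.exp (-2 : ℤ) < 1 := by
      rw [← WithZero.exp_zero, WithZero.exp_lt_exp]; norm_num
    have hr1 : Valued.v C.r = 1 := by
      have h3r : Valued.v (3 * C.r) = 1 := by
        have : (3 : v.adicCompletion ℚ) * C.r = 1 + (3 * C.r - 1) := by ring
        rw [this, Valuation.map_add_eq_of_lt_left, Valuation.map_one]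
        rw [Valuation.map_one]
        exact lt_of_le_of_lt h3r1 hlt1
      rwa [Valuation.map_mul, V3, one_mul] at h3r
    have hr21 := valued_sq_sub_one_le_of_valued_eq_one v hv hr1
    have hm21 := valued_sq_sub_one_le_of_valued_eq_one v hv Vm
    have hA : Valued.v (3 * C.r ^ 2 - 3) ≤ WithZero.exp (-3 : ℤ) := by
      have : (3 : v.adicCompletion ℚ) * C.r ^ 2 - 3 = 3 * (C.r ^ 2 - 1) := by ring
      rw [this, Valuation.map_mul, V3, one_mul]
      exact hr21
    have hB : Valued.v (((2 : v.adicCompletion ℚ) * m) ^ 2 - 4) ≤ WithZero.exp (-3 : ℤ) := by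
      have : ((2 : v.adicCompletion ℚ) * m) ^ 2 - 4 = 4 * ((m : v.adicCompletion ℚ) ^ 2 - 1) := by
        ring
      rw [this, Valuation.map_mul, V4]
      calc WithZero.exp (-2 : ℤ) * Valued.v ((m : v.adicCompletion ℚ) ^ 2 - 1)
          ≤ WithZero.exp (-2 : ℤ) * WithZero.exp (-3 : ℤ) := mul_le_mul' le_rfl hm21
        _ ≤ WithZero.exp (-3 : ℤ) := by
            rw [withZero_exp_mul_exp, WithZero.exp_le_exp]; norm_num
    have hC' : Valued.v (2 * C.s * C.t) ≤ WithZero.exp (-3 : ℤ) := by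
      rw [Valuation.map_mul, Valuation.map_mul, V2, hseq, mul_one]
      calc WithZero.exp (-1 : ℤ) * Valued.v C.t ≤ WithZero.exp (-1 : ℤ) * WithZero.exp (-2 : ℤ) :=
            mul_le_mul' le_rfl ht
        _ = WithZero.exp (-3 : ℤ) := by rw [withZero_exp_mul_exp]; norm_num
    have hbr : Valued.v (-(((2 : v.adicCompletion ℚ) * m) ^ 2 - 4) + (3 * C.r ^ 2 - 3) -
        2 * C.s * C.t) ≤ WithZero.exp (-3 : ℤ) :=
      Valuation.map_sub_le _ (Valuation.map_add_le _ (by rwa [Valuation.map_neg]) hA) hC'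
    have hlt3 : WithZero.exp (-3 : ℤ) < 1 := by
      rw [← WithZero.exp_zero, WithZero.exp_lt_exp]; norm_num
    have hE1 : Valued.v (-((2 : v.adicCompletion ℚ) * m) ^ 2 + 3 * C.r ^ 2 - 2 * C.s * C.t) = 1 := by
      have : -((2 : v.adicCompletion ℚ) * m) ^ 2 + 3 * C.r ^ 2 - 2 * C.s * C.t =
          -1 + (-(((2 : v.adicCompletion ℚ) * m) ^ 2 - 4) + (3 * C.r ^ 2 - 3) - 2 * C.s * C.t) := by
        ring
      rw [this, Valuation.map_add_eq_of_lt_left, Valuation.map_neg, Valuation.map_one]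
      rw [Valuation.map_neg, Valuation.map_one]
      exact lt_of_le_of_lt hbr hlt3
    rw [hE1, ← WithZero.exp_zero, WithZero.exp_le_exp] at hE
    norm_num at hE

end Minimal

/-! ### Additive reduction at every `p ∣ 2n` and the vanishing of `a_p(E_n)` there -/

section Consequences

open Rat.HeightOneSpectrum

variable (v : HeightOneSpectrum (NumberField.RingOfIntegers ℚ))

/-- **`E_n` has additive reduction at `2` for even squarefree `n`**: the equation is minimal at
`2` (`isMinimalAt_congruentNumberCurve_two_of_even`) with `ord₂(Δ) = 12 > 0` and
`ord₂(c₄) = ord₂(48 n²) > 0` (Silverman VII.5, Prop. 5.1(c)).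
[cite: SilvermanAEC2009, VII.5 Prop. 5.1(c) and VII.1 Prop. 1.3(b)] -/
theorem hasAdditiveReductionAt_congruentNumberCurve_two_of_even {n : ℕ} (hsq : Squarefree n)
    (heven : Even n) (hv : natGenerator v = 2) :
    (congruentNumberCurve n).HasAdditiveReductionAt v := by
  have hmin := isMinimalAt_congruentNumberCurve_two_of_even v hsq heven hv
  obtain ⟨m, rfl, hm⟩ := exists_eq_two_mul_odd_of_squarefree_of_even hsq heven
  refine hasAdditiveReductionAt_of_isMinimalAt v _ hmin ?_
    (valuation_congruentNumberCurve_c₄_lt_one v (hv ▸ dvd_mul_right 2 (2 * m))) ?_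
  · rw [valuation_congruentNumberCurve_Δ_of_even v hv hm, ← WithZero.exp_zero,
      WithZero.exp_lt_exp]
    norm_num
  · rw [congruentNumberCurve_Δ]
    have hm0 : ((2 * m : ℕ) : ℚ) ≠ 0 := by
      have : 2 * m ≠ 0 := by have := hm.pos; omega
      exact_mod_cast this
    exact mul_ne_zero (by norm_num) (pow_ne_zero _ hm0)

/-- **For squarefree `n`, `E_n : y² = x³ - n² x` has additive reduction at every prime dividing
`2n`** (odd `p ∣ n` and `p = 2` with `n` odd: `CongruentNumberCurveAdditiveReduction`, by
Silverman's Remark VII.1.1; `p = 2` with `n` even: this file). This is why the printed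
`L`-function of `E_n` is the product over `p ∤ 2n` only (Top–Yui §3, p. 617; Ireland–Rosen
Ch. 18 §2 (xi), §6). [cite: SilvermanAEC2009, VII.5 Prop. 5.1(c)]
[cite: TopYui2008Congruent, §3, p. 617 (L(C_n,s) = ∏_{p ∤ 2n})] -/
theorem hasAdditiveReductionAt_congruentNumberCurve {n : ℕ} (hsq : Squarefree n)
    (hv : natGenerator v ∣ 2 * n) : (congruentNumberCurve n).HasAdditiveReductionAt v := by
  by_cases h2 : natGenerator v = 2
  · rcases Nat.even_or_odd n with heven | hodd
    · exact hasAdditiveReductionAt_congruentNumberCurve_two_of_even v hsq heven h2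
    · exact hasAdditiveReductionAt_congruentNumberCurve_two v hodd h2
  · have hp := prime_natGenerator v
    have hpn : natGenerator v ∣ n := by
      rcases (Nat.Prime.dvd_mul hp).mp hv with h | h
      · exact absurd ((Nat.prime_dvd_prime_iff_eq hp Nat.prime_two).mp h) h2
      · exact h
    exact hasAdditiveReductionAt_congruentNumberCurve_of_dvd v hsq h2 hpn

/-- **`a₂(E_n) = 0` for even squarefree `n`** (additive reduction at `2`; Silverman §C.16).
[cite: SilvermanAEC2009, §C.16 (definition of L_v(T))] -/
theorem lFunction_congruentNumberCurve_apply_two_of_even {n : ℕ} (hsq : Squarefree n)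
    (heven : Even n) : (congruentNumberCurve n).LFunction 2 = 0 := by
  obtain ⟨v, hv⟩ : ∃ v : HeightOneSpectrum (NumberField.RingOfIntegers ℚ),
      (primesEquiv v : ℕ) = 2 := ⟨primesEquiv.symm ⟨2, Nat.prime_two⟩, by rw [Equiv.apply_symm_apply]⟩
  rw [← hv]
  exact lFunction_apply_eq_zero_of_hasAdditiveReductionAt v _
    (hasAdditiveReductionAt_congruentNumberCurve_two_of_even v hsq heven hv)

/-- **`a_p(E_n) = 0` for every prime `p ∣ 2n`, `n` squarefree**: the `p`-th Dirichlet coefficient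
of Mathlib's complete `L(E_n, s)` vanishes at the primes omitted from the printed product
`L(C_n, s) = ∏_{p ∤ 2n} (1 - a_p p^{-s} + p^{1-2s})^{-1}` (Top–Yui §3, p. 617), because `E_n` has
additive reduction there (`hasAdditiveReductionAt_congruentNumberCurve`; local factor `1`,
Silverman §C.16). Together with `Literature.NumberTheory.Automorphic.lFunction_map_apply_prime_of_not_dvd` (at `p ∤ 2n` the
coefficient is `p + 1 - #Ẽ_n(𝔽_p)`), this identifies the prime coefficients of Mathlib's
`L(E_n, s)` with the printed ones for every squarefree `n`.
[cite: TopYui2008Congruent, §3, p. 617 (L(C_n,s) = ∏_{p ∤ 2n})]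
[cite: SilvermanAEC2009, §C.16 (definition of L_v(T))] -/
theorem lFunction_congruentNumberCurve_apply_eq_zero_of_dvd_two_mul {n : ℕ} (hsq : Squarefree n)
    {p : ℕ} (hp : p.Prime) (hpn : p ∣ 2 * n) : (congruentNumberCurve n).LFunction p = 0 := by
  obtain ⟨v, rfl⟩ : ∃ v : HeightOneSpectrum (NumberField.RingOfIntegers ℚ),
      (primesEquiv v : ℕ) = p := ⟨primesEquiv.symm ⟨p, hp⟩, by rw [Equiv.apply_symm_apply]⟩
  exact lFunction_apply_eq_zero_of_hasAdditiveReductionAt v _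
    (hasAdditiveReductionAt_congruentNumberCurve v hsq hpn)

/-- A prime not dividing `2n` does not divide `Δ(E_n) = 64 n⁶`. [folklore] -/
theorem not_dvd_congruentNumberCurveInt_Δ_of_not_dvd {p : ℕ} (hp : p.Prime) {n : ℕ}
    (hpn : ¬ p ∣ 2 * n) : ¬ (p : ℤ) ∣ (congruentNumberCurveInt n).Δ := by
  rw [congruentNumberCurveInt_Δ]
  intro h
  have h' : p ∣ 64 * n ^ 6 := by exact_mod_cast h
  rcases (Nat.Prime.dvd_mul hp).mp h' with h64 | hn6
  · have h2 : p ∣ 2 := hp.dvd_of_dvd_pow (show p ∣ 2 ^ 6 by simpa using h64)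
    exact hpn (h2.mul_right n)
  · exact hpn ((hp.dvd_of_dvd_pow hn6).mul_left 2)

/-- **The prime Dirichlet coefficients of Mathlib's `L(E_n, s)` are the printed ones** (Top–Yui
§3, p. 617: `L(C_n, s) = ∏_{p ∤ 2n} (1 - a_p p^{-s} + p^{1-2s})^{-1}`, `a_p = p + 1 - #C̃_n(𝔽_p)`,
for squarefree `n`; Ireland–Rosen Ch. 18 §2 (xi), §6): for every squarefree `n` and every prime
`p`, the `p`-th coefficient of `WeierstrassCurve.LFunction (congruentNumberCurve n)` is `0` if
`p ∣ 2n` (additive reduction, `lFunction_congruentNumberCurve_apply_eq_zero_of_dvd_two_mul`) and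
`p + 1 - #Ẽ_n(𝔽_p)` otherwise (good reduction of the model `⟨0, 0, 0, -n², 0⟩`,
`Literature.NumberTheory.Automorphic.lFunction_map_apply_prime_of_not_dvd`), `#Ẽ_n(𝔽_p) = Literature.Lang.numPointsMod` of the
`ℤ`-model `congruentNumberCurveInt n`.
[cite: TopYui2008Congruent, §3, p. 617 (L(C_n,s) = ∏_{p ∤ 2n}, a_p = p + 1 - #C̃_n(𝔽_p))]
[cite: SilvermanAEC2009, §C.16 (definition of L_v(T)) and Exercise 8.19(a)] -/
theorem lFunction_congruentNumberCurve_apply_prime {n : ℕ} (hsq : Squarefree n) {p : ℕ}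
    (hp : p.Prime) :
    (congruentNumberCurve n).LFunction p =
      if p ∣ 2 * n then 0
      else (p : ℤ) + 1 - (Literature.NumberTheory.Automorphic.numPointsMod (congruentNumberCurveInt n) p : ℤ) := by
  split_ifs with h
  · exact lFunction_congruentNumberCurve_apply_eq_zero_of_dvd_two_mul hsq hp h
  · rw [← map_congruentNumberCurveInt_intCast, Literature.NumberTheory.Automorphic.lFunction_map_apply_prime_of_not_dvd _ hp
      (not_dvd_congruentNumberCurveInt_Δ_of_not_dvd hp h), Literature.NumberTheory.Automorphic.frobeniusTrace]

end Consequences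

end Literature.NumberTheory.EllipticCurves

end
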